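import Mathlib
import Summits.Ventures.PercRepro2.Tail2DBlockCalc
import Summits.Ventures.PercRepro2.Tail2DHarrisSP
import Summits.Ventures.PercRepro2.Tail2DFlowOneBlocks
import Summits.Ventures.PercRepro2.Tail2DFlowOnePar
import Summits.Ventures.PercRepro2.Tail2DSDomSwap
import Summits.Ventures.PercRepro2.Tail2DFlowOneStep01
import Summits.Ventures.PercRepro2.Tail2DFlowOneThreeCounts
import Summits.Ventures.PercRepro2.Tail2DParFin
import Summits.Ventures.PercRepro2.Tail2DFlowOneAxis
import Summits.Ventures.PercRepro2.Tail2DAxisClass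
import Summits.Ventures.PercRepro2.Tail2DRelayBlocks
import Summits.Ventures.PercRepro2.Tail2DRelay20Comb

/-!
# The two-dimensional recursion of the tails of `X ∥ Y` for a flow-one `X`
(seat mine-b, cell pub-perc-repro2; conjectures/MINE-B.md §45.12)

`T'(i+1,j+1) = a T(i,j+1) + a T(i+1,j) + c T(i+1,j+1)`, `T'(i+1,0) = a T(i,0) + (a+c) T(i+1,0)`,
`T'(0,j+1) = (a+c) T(0,j+1) + a T(0,j)`, `T'(0,0) = (2a+c) T(0,0)` (`a = #R_X`, `c = #C_X`), and the tails of the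
absent edge — with these four rules `simp only` expands every tail count of a comb into a polynomial in the sizes of
its factors (used in `Tail2DFiveGen.lean`).
-/

namespace Summit.Ventures.PercRepro2.Tail2D

open V2Closure Finset

section Recursion

variable (X Y : V2Closure.SP)

/-- `E(i+1,j+1)` of `X ∥ Y` for flow-one `X`: `R × E_Y(i,j+1) ⊔ B × E_Y(i+1,j) ⊔ C × E_Y(i+1,j+1)` -/
theorem tailSet_par_succ_succ (hX : FlowOne X) (i j : ℕ) :
    tailSet (V2Closure.SP.par X Y) (i + 1) (j + 1)
      = (((rSet X ×ˢ tailSet Y i (j + 1) : Finset (X.Conf × Y.Conf))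
          ∪ (bSet X ×ˢ tailSet Y (i + 1) j : Finset (X.Conf × Y.Conf)))
          ∪ (cellSet X ×ˢ tailSet Y (i + 1) (j + 1) : Finset (X.Conf × Y.Conf))) := by
  apply Finset.ext; intro p
  rw [mem_tailSet_par']
  refine Iff.trans ?_ Finset.mem_union.symm
  refine Iff.trans ?_ (or_congr Finset.mem_union Iff.rfl).symm
  refine Iff.trans ?_ (or_congr (or_congr Finset.mem_product Finset.mem_product) Finset.mem_product).symm
  rw [mem_rSet, mem_bSet, mem_cellSet, mem_tailSet_iff, mem_tailSet_iff, mem_tailSet_iff]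
  have := hX p.1
  omega

/-- `T'(i+1,j+1) = a T(i,j+1) + a T(i+1,j) + c T(i+1,j+1)` -/
theorem tailCount_par_succ_succ (hX : FlowOne X) (i j : ℕ) :
    tailCount (V2Closure.SP.par X Y) (i + 1) (j + 1)
      = (rSet X).card * tailCount Y i (j + 1) + (rSet X).card * tailCount Y (i + 1) j
        + (cellSet X).card * tailCount Y (i + 1) (j + 1) := by
  rw [tailCount_eq_card, tailSet_par_succ_succ X Y hX i j]
  show (((rSet X ×ˢ tailSet Y i (j + 1) : Finset (X.Conf × Y.Conf))
      ∪ (bSet X ×ˢ tailSet Y (i + 1) j : Finset (X.Conf × Y.Conf)))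
      ∪ (cellSet X ×ˢ tailSet Y (i + 1) (j + 1) : Finset (X.Conf × Y.Conf))).card = _
  rw [Finset.card_union_of_disjoint, Finset.card_union_of_disjoint, Finset.card_product, Finset.card_product,
    Finset.card_product, card_bSet_eq, tailCount_eq_card, tailCount_eq_card, tailCount_eq_card]
  · rw [Finset.disjoint_left]
    intro p h1 h2
    rw [Finset.mem_product, mem_rSet] at h1
    rw [Finset.mem_product, mem_bSet] at h2
    have := hX p.1
    omega
  · rw [Finset.disjoint_left]
    intro p h1 h2
    rw [Finset.mem_union, Finset.mem_product, Finset.mem_product, mem_rSet, mem_bSet] at h1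
    rw [Finset.mem_product, mem_cellSet] at h2
    omega

/-- `E(i+1,0)` of `X ∥ Y` for flow-one `X`: `R × E_Y(i,0) ⊔ col × E_Y(i+1,0)` -/
theorem tailSet_par_succ_zero (hX : FlowOne X) (i : ℕ) :
    tailSet (V2Closure.SP.par X Y) (i + 1) 0
      = ((rSet X ×ˢ tailSet Y i 0 : Finset (X.Conf × Y.Conf))
          ∪ (colSet X ×ˢ tailSet Y (i + 1) 0 : Finset (X.Conf × Y.Conf))) := by
  apply Finset.ext; intro p
  rw [mem_tailSet_par']
  refine Iff.trans ?_ Finset.mem_union.symm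
  refine Iff.trans ?_ (or_congr Finset.mem_product Finset.mem_product).symm
  rw [mem_rSet, mem_colSet, mem_tailSet_iff, mem_tailSet_iff]
  have := hX p.1
  omega

/-- `T'(i+1,0) = a T(i,0) + (a+c) T(i+1,0)` -/
theorem tailCount_par_succ_zero (hX : FlowOne X) (i : ℕ) :
    tailCount (V2Closure.SP.par X Y) (i + 1) 0
      = (rSet X).card * tailCount Y i 0 + ((rSet X).card + (cellSet X).card) * tailCount Y (i + 1) 0 := by
  rw [tailCount_eq_card, tailSet_par_succ_zero X Y hX i]
  show ((rSet X ×ˢ tailSet Y i 0 : Finset (X.Conf × Y.Conf))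
      ∪ (colSet X ×ˢ tailSet Y (i + 1) 0 : Finset (X.Conf × Y.Conf))).card = _
  rw [Finset.card_union_of_disjoint, Finset.card_product, Finset.card_product, ← card_cellSet_add X hX,
    tailCount_eq_card, tailCount_eq_card, Nat.add_comm (cellSet X).card]
  rw [Finset.disjoint_left]
  intro p h1 h2
  rw [Finset.mem_product, mem_rSet] at h1
  rw [Finset.mem_product, mem_colSet] at h2
  omega

/-- `E(0,j+1)` of `X ∥ Y` for flow-one `X`: `row × E_Y(0,j+1) ⊔ B × E_Y(0,j)` -/
theorem tailSet_par_zero_succ (hX : FlowOne X) (j : ℕ) :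
    tailSet (V2Closure.SP.par X Y) 0 (j + 1)
      = ((rowSet X 0 ×ˢ tailSet Y 0 (j + 1) : Finset (X.Conf × Y.Conf))
          ∪ (bSet X ×ˢ tailSet Y 0 j : Finset (X.Conf × Y.Conf))) := by
  apply Finset.ext; intro p
  rw [mem_tailSet_par']
  refine Iff.trans ?_ Finset.mem_union.symm
  refine Iff.trans ?_ (or_congr Finset.mem_product Finset.mem_product).symm
  rw [mem_rowSet0, mem_bSet, mem_tailSet_iff, mem_tailSet_iff]
  have := hX p.1
  omega

/-- `T'(0,j+1) = (a+c) T(0,j+1) + a T(0,j)` -/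
theorem tailCount_par_zero_succ (hX : FlowOne X) (j : ℕ) :
    tailCount (V2Closure.SP.par X Y) 0 (j + 1)
      = ((rSet X).card + (cellSet X).card) * tailCount Y 0 (j + 1) + (rSet X).card * tailCount Y 0 j := by
  rw [tailCount_eq_card, tailSet_par_zero_succ X Y hX j]
  show ((rowSet X 0 ×ˢ tailSet Y 0 (j + 1) : Finset (X.Conf × Y.Conf))
      ∪ (bSet X ×ˢ tailSet Y 0 j : Finset (X.Conf × Y.Conf))).card = _
  rw [Finset.card_union_of_disjoint, Finset.card_product, Finset.card_product, card_rowSet0, card_bSet_eq,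
    ← card_colSet X hX, ← card_cellSet_add X hX, tailCount_eq_card, tailCount_eq_card, Nat.add_comm (cellSet X).card]
  rw [Finset.disjoint_left]
  intro p h1 h2
  rw [Finset.mem_product, mem_rowSet0] at h1
  rw [Finset.mem_product, mem_bSet] at h2
  omega

/-- `T'(0,0) = (2a+c) T(0,0)` -/
theorem tailCount_par_zero_zero (hX : FlowOne X) :
    tailCount (V2Closure.SP.par X Y) 0 0 = (2 * (rSet X).card + (cellSet X).card) * tailCount Y 0 0 := by
  rw [tailCount_par_00, card_conf_flowOne X hX, tailCount_zero_zero]; ring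

/-- the tails of the absent edge: `T(0,0) = 1`, the rest `0` -/
theorem tailCount_absent_eq (i j : ℕ) :
    tailCount V2Closure.SP.absent i j = if i = 0 ∧ j = 0 then 1 else 0 := by
  by_cases h : i = 0 ∧ j = 0
  · obtain ⟨rfl, rfl⟩ := h
    rw [if_pos ⟨rfl, rfl⟩, tailCount_zero_zero]; rfl
  · rw [if_neg h]
    rcases Nat.eq_zero_or_pos i with hi | hi
    · subst hi
      exact tailCount_absent_pos j (by omega)
    · exact tailCount_absent_red i j hi

end Recursion

end Summit.Ventures.PercRepro2.Tail2D
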